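import Summits.BirchSwinnertonDyer.Rank1Residual.GaloisImage.KolyvaginSystemOfEulerSystemPair
import Summits.BirchSwinnertonDyer.Rank1Residual.GaloisImage.KolyvaginSystemOfEulerSystemTorsionCoeff
import Summits.BirchSwinnertonDyer.Rank1Residual.GaloisImage.KatoKuriharaValueGeneralLevelParity
import Summits.BirchSwinnertonDyer.Rank1Residual.GaloisImage.KatoKuriharaDictionaryThree
import HarnessLib

/-!
# The TWO-DEPTH Kato–Kurihara witness package from Kato's Euler system: both single-level witness
# clause sets of DICT3₂ and its reduction compatibility (COMP), for THE Kolyvagin systems of THEOREM D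
# at depths `k ≤ m`, modulo the per-level VALUE inputs (sub-target ★ PK-6₂, THEOREM-D / parity half;
# cell `b2b-bsdres`, team n1011, seat p13 GEN 14 — PK-6 lineage; lead R5-111 (a)/(γ), R5-112 (a))

HONEST FRAMING (cell `b2b-bsdres`, run/shared/lean/b2b/bsd-rank1-residual/, verbatim in every
file): the goal of the cell is to DELETE the COMBINATION-SHAPED residual classes of the
Birch–Swinnerton-Dyer formula for ALL analytic-rank `≤ 1` elliptic curves over `ℚ` — "full BSD
formula for every rank `≤ 1` curve in class `C`" assembled STRICTLY from published theorems — so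
that the rank-`≤ 1` remainder becomes exactly the CONSTRUCTION-SHAPED classes, which are TYPED
(missing-input `Prop`s), NOT attempted. This is not "finishing BSD". Team n1011 (N10/N11; ROUTE 1,
the PORT anatomy (P-KIM) of class X4 ∧ `p = 3`): research route on CONSTRUCTION-SHAPED classes;
prove what is provable now; no claim beyond stated classes; census output = EVIDENCE, never a
Literature fact; RESIDUAL-MAP marks UNCHANGED; nothing is booked by this file.  TOOL THEOREM ONLY:
no definition, no named fact, no instance, no `sorry`; Kato's `ZetaBody` (witnesses bound, never
obtained — ROUTE-1 §48.4 socket), the (P-EXP) riders `KatoExpStarFiniteLevelAt` at the two depths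
(PK-5; CONSTRUCTION-SHAPED, never `_holds`) and the per-level VALUE rows enter as DISPLAYED
HYPOTHESES; the target predicates DICT3₂ / PORT′ are NOT asserted here (their wrapper is ★ PK-6₂,
after n1011-p18's T-PORT-FIX); closes nothing on N11.

## What

For `W/ℚ` globally minimal, a modular parametrisation datum `P` (the newform is `P.f`), Kato's
witnesses `(ι κ Λ c d a A z x)` with `hbody : ZetaBody W 3 P.f ι κ Λ c d a A z x`, depths `k ≤ m`, THE
reduction `π : E[3^m·3] → E[3^k·3]` pinned by `x ↦ 3^{m−k}·x`, riders `hfink` / `hfinm` at `v₃ ∣ 3`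
for the SAME `Λ`, two Kolyvagin data `D` (depth `k`) and `D″` (depth `m`) canonical for the SAME
generator family `η` with primes usable for Kato's system and Kolyvagin of the right levels, THEOREM
D's row binders (`hbad`, `htopk`, `htopm`) and, at each depth, the VALUE ROWS for every admissible
generator family `σ` (`σ_q ∈ I_q`, `χ_{Nq}(σ_q) = η_q`) and every level `r ⊆ 𝒫`: a scalar `s`, a
unit `u`, discrete logarithms `ψ` onto, the plus-symmetrised congruence
`3^t·(1 ⊗ D^{field}_r (x_{0,r} + σ₋₁ x_{0,r})) − s ⊗ 1 ∈ 3^{k+1}·L_int` and the reading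
`s mod 3^{k+1} = u · 3^t · δ̃_{n(r)}(ψ)` (the OUT of n1011-p02's T-PK6-VAL FILE 1 (V3)/(V4) + FILE 3 on
n1011-p15's PK-4b-C; DISPLAYED here):

★★ `exists_katoKuriharaWitnessAt_pair_of_zetaBody` — there are families `κ` (depth `k`) and `κu`
(depth `m`) such that `KatoKuriharaWitnessAt W k t D v₃ P κ Λfinₖ κ`, `KatoKuriharaWitnessAt W m t D″
v₃ P κu Λfinₘ κu` (all four clauses (0)/(I4)/(Λ)/(DICT3) at each depth, with the Kolyvagin system
`κ′ := κ` itself — Kato's derivative family IS a Kolyvagin system for `𝓕_can`, THEOREM D) and (COMP)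
`π_* (κu d) = κ d` on every common level — i.e. the CONCLUSION of p09's two-level dictionary
`KatoKuriharaDictionaryThreeAt₂` at `P` with `κ′ = κ`, `κu′ = κu`.  Proof = composition BY NAME:
n1011-p11's D7 `Derivative.Rat.exists_isKolyvaginSystem_pair_propagatedSelmerStructure` (ONE Euler
system `z`, `hc := hbody.1`; ONE `σ` with `χ_{Nq}(σ_q) = η_q` for both depths; coefficients
`E[3^{j+1}]_{ℤ₃}` via GZ-2's `tateModuleRed`, pins `rfl` — n1011-p11's D6 reading) ⟶ (0) =
`hKS.mem_selmerGroup`, (I4) = `0 ∈ closure`, (Λ) = the rider's clause (i), (DICT3) at level `r` =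
n1011-p13's T-PK6-GEN ★ `KatoValue.GeneralLevel.exists_unit_apply_localization_eq_of_derivativeFamily`
fed the value row of `(σ, r)`, (COMP) = D7's last clause.

HONEST LIMITS: the value rows are hypotheses (`hvalk`, `hvalm`); `htopk`/`htopm` (= `E(ℚ₃)[3] = 0`,
Mazur–Rubin Lemma A.1) restrict to `t = 0` rows in practice; `hbad` excludes the 3-anomalous bad
places (END-b's population); nothing about `Λfin`'s construction; closes nothing; 0 defs / 0 facts.

References: K. Kato, Astérisque 295 (2004) §9.4, Thm. 9.7 [Kato2004Asterisque]; C.-H. Kim, AJM 148 =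
arXiv:2203.12159, §2.2.2, §3.3–§3.4.1, Thm. 3.13 [Kim2022StructureSelmer]; B. Mazur, K. Rubin, Mem.
AMS 799 (2004), Def. 3.1.3, Thm. 3.2.4, App. A [MazurRubin2004]; K. Rubin, *Euler Systems* (2000),
Def. 4.4.1, 4.4.4 [Rubin2000]; R. Sakamoto, JTNB 36 (2024) Def. 4.1 [Sakamoto2024]; design
`cells/n1011/ROUTE-1.md` §56.3 (B), §58 D-58-1; lead R5-110 (k), R5-111 (a)/(γ), R5-112 (a).
-/

noncomputable section

open scoped NumberField TensorProduct ContRepresentation Classical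
open CategoryTheory Field Function Finset IsDedekindDomain NumberField WeierstrassCurve
open Rat.HeightOneSpectrum
open Literature.NumberTheory.GaloisRepresentations Literature.NumberTheory.GaloisCohomology
open Literature.NumberTheory.GaloisRepresentations.DiscreteGaloisModule
open Literature.NumberTheory.EllipticCurves Literature.NumberTheory.EllipticCurves.ModularForms
open Literature.NumberTheory.EllipticCurves.Kato2004
open Literature.NumberTheory.EllipticCurves.Kato2004.EulerSystemValues
open Summit.BirchSwinnertonDyer.Rank1Residual.GaloisImage.TorsionCoeff

namespace Summit.BirchSwinnertonDyer.Rank1Residual.GaloisImage.KatoValue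

variable (W : WeierstrassCurve ℚ) [W.IsElliptic] [W.IsGloballyMinimal]
  [ContinuousSMul ℤ_[3] (W.tateModule 3)] [Module.Free ℤ_[3] (W.tateModule 3)]
  [Module.Finite ℤ_[3] (W.tateModule 3)]

/-- Local notation: `𝐃F⟦r, τ⟧ ℓ = Σ_{j<ℓ−1} j·σ_{χ_{m(0,r)}(τ_ℓ)}^j` on the level field `ℚ(ζ_{m(0,r)})`
(PK-1 ★2's field-side spelling, `p = 3`). -/
local notation3 (prettyPrint := false) "𝐃F⟦" r ", " τ "⟧" =>
  fun ℓ : HeightOneSpectrum (𝓞 ℚ) =>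
  ∑ j ∈ Finset.range (((primesEquiv ℓ : Nat.Primes) : ℕ) - 1),
    (j : Module.End ℚ (CyclotomicField (cycLevel 3 0 r) ℚ)) *
      (sigma (cycLevel 3 0 r) (modNCyclotomicCharacter ℚ (cycLevel 3 0 r)
          ((τ : HeightOneSpectrum (𝓞 ℚ) → absoluteGaloisGroup ℚ) ℓ)) :
        CyclotomicField (cycLevel 3 0 r) ℚ →ₐ[ℚ] CyclotomicField (cycLevel 3 0 r) ℚ).toLinearMap ^ j

set_option backward.isDefEq.respectTransparency false in
/-- **★★ The two-depth Kato–Kurihara witness package from `ZetaBody`, THEOREM D and the value rows**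
(module docstring): the conclusion of `KatoKuriharaDictionaryThreeAt₂ W t k m D D″ π v₃` at the
parametrisation datum `P`, with `κ′ = κ`, `κu′ = κu` THE Kolyvagin systems of THEOREM D for Kato's
Euler system at depths `k` and `m`.
[cite: Kato2004Asterisque, §9.4 (p. 188) and Thm. 9.7 (p. 189)]
[cite: Kim2022StructureSelmer, Thm. 3.13 and §2.2.2, §3.3–§3.4.1 (arXiv v3 pp. 12, 17–18, 26–27)]
[cite: MazurRubin2004, Def. 3.1.3, Thm. 3.2.4 and App. A] [cite: Rubin2000, Def. 4.4.4] -/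
theorem exists_katoKuriharaWitnessAt_pair_of_zetaBody
    {N : ℕ} [NeZero N] (P : ModularParametrizationData W N)
    {ι : (n : ℕ) → (CyclotomicField n ℚ →+* ℂ)} {κK : ℝ}
    {Λ : ∀ (k' : ℕ) (r : Finset (HeightOneSpectrum (𝓞 ℚ))),
      H1 (tateRep W 3) (cycSubgroup 3 k' r) →ₗ[ℤ_[3]] ℚ_[3] ⊗[ℚ] CyclotomicField (cycLevel 3 k' r) ℚ}
    {c d a : ℤ} {A : ℕ}
    {z : ∀ (k' : ℕ) (r : (cyclotomicLevelsRat 3 (badPlaces c d A N)).Ideals),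
      H1 (tateRep W 3) ((cyclotomicLevelsRat 3 (badPlaces c d A N)).level k' r.1)}
    {x : ∀ (k' : ℕ) (r : (cyclotomicLevelsRat 3 (badPlaces c d A N)).Ideals),
      CyclotomicField (cycLevel 3 k' r.1) ℚ}
    (hbody : ZetaBody W 3 P.f ι κK Λ c d a A z x)
    (hirr : W.HasIrreducibleModPGaloisRep 3)
    -- the two depths and THE reduction
    {k m : ℕ} (hkm : k ≤ m)
    (π : (W.torsionGaloisModule (((3 : ℕ) : ℤ) ^ m * ((3 : ℕ) : ℤ))).toContRepresentation →ⁱL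
      (W.torsionGaloisModule (((3 : ℕ) : ℤ) ^ k * ((3 : ℕ) : ℤ))).toContRepresentation)
    (hπ : ∀ y : geomTorsion W (((3 : ℕ) : ℤ) ^ m * ((3 : ℕ) : ℤ)),
      ((π y : geomTorsion W (((3 : ℕ) : ℤ) ^ k * ((3 : ℕ) : ℤ))) : geomPoints W) =
        (((3 : ℕ) : ℤ) ^ (m - k)) • (y : geomPoints W))
    -- the riders at `v₃ ∣ 3`, depths `k` and `m`, same `Λ`
    {t : ℕ} {v₃ : HeightOneSpectrum (𝓞 ℚ)} (hv₃ : ((3 : ℕ) : 𝓞 ℚ) ∈ v₃.asIdeal)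
    {Λk : galoisCohomology ((W.torsionGaloisModule (((3 : ℕ) : ℤ) ^ k * ((3 : ℕ) : ℤ))).toLocal
      (Sum.inr v₃)) 1 →+ ZMod (3 ^ (k + 1))}
    {Λm : galoisCohomology ((W.torsionGaloisModule (((3 : ℕ) : ℤ) ^ m * ((3 : ℕ) : ℤ))).toLocal
      (Sum.inr v₃)) 1 →+ ZMod (3 ^ (m + 1))}
    (hfink : KatoExpStarFiniteLevelAt W 3 k t v₃ Λ Λk) (hfinm : KatoExpStarFiniteLevelAt W 3 m t v₃ Λ Λm)
    -- the two data, canonical for the SAME `η`, with usable Kolyvagin primes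
    (D : KolyvaginDatum (W.torsionGaloisModule (((3 : ℕ) : ℤ) ^ k * ((3 : ℕ) : ℤ))))
    (hT : D.transverse = cyclotomicTransverse (W.torsionGaloisModule (((3 : ℕ) : ℤ) ^ k * ((3 : ℕ) : ℤ))))
    (D'' : KolyvaginDatum (W.torsionGaloisModule (((3 : ℕ) : ℤ) ^ m * ((3 : ℕ) : ℤ))))
    (hT'' : D''.transverse =
      cyclotomicTransverse (W.torsionGaloisModule (((3 : ℕ) : ℤ) ^ m * ((3 : ℕ) : ℤ))))
    {η : (q : HeightOneSpectrum (𝓞 ℚ)) → (ZMod (Ideal.absNorm q.asIdeal))ˣ}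
    (hD : D.HasCanonicalComparison (3 ^ (k + 1)) η) (hD'' : D''.HasCanonicalComparison (3 ^ (m + 1)) η)
    (hPr : D.primes ⊆ (cyclotomicLevelsRat 3 (badPlaces c d A N)).primes)
    (hPr'' : D''.primes ⊆ (cyclotomicLevelsRat 3 (badPlaces c d A N)).primes)
    (hKol : ∀ q ∈ D.primes, Kato.IsKolyvaginPrime W 3 (k + 1) ((primesEquiv q : Nat.Primes) : ℕ))
    (hKol'' : ∀ q ∈ D''.primes, Kato.IsKolyvaginPrime W 3 (m + 1) ((primesEquiv q : Nat.Primes) : ℕ))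
    -- THEOREM D's row binders
    (hbad : ∀ w : HeightOneSpectrum (𝓞 ℚ), ¬ W.HasGoodReductionAt w →
      ((primesEquiv w : Nat.Primes) : ℕ) ≠ 3 →
        ∀ Q : (W.baseChange (w.adicCompletion ℚ)).toAffine.Point, 3 • Q = 0 → Q = 0)
    (htopk : ∀ w : HeightOneSpectrum (𝓞 ℚ), ((primesEquiv w : Nat.Primes) : ℕ) = 3 →
      propagatedSelmerStructure W 3 k (Sum.inr w) = ⊤)
    (htopm : ∀ w : HeightOneSpectrum (𝓞 ℚ), ((primesEquiv w : Nat.Primes) : ℕ) = 3 →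
      propagatedSelmerStructure W 3 m (Sum.inr w) = ⊤)
    -- the VALUE ROWS at depth `k` and at depth `m` (T-PK6-VAL's OUT, displayed)
    (hvalk : ∀ σ : HeightOneSpectrum (𝓞 ℚ) → absoluteGaloisGroup ℚ,
      (∀ q, σ q ∈ (adicCompletionPrime ℚ q).inertia (absoluteGaloisGroup ℚ)) →
      (∀ q, modNCyclotomicCharacter ℚ (Ideal.absNorm q.asIdeal) (σ q) = η q) →
      ∀ (r : Finset (HeightOneSpectrum (𝓞 ℚ))) (hr : (↑r : Set _) ⊆ D.primes),
        ∃ (s : ℤ_[3]) (u : (ZMod (3 ^ (k + 1)))ˣ)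
          (ψ : (ℓ : ℕ) → (ZMod ℓ)ˣ →* Multiplicative (ZMod (3 ^ (k + 1)))),
          (∀ q ∈ r, Function.Surjective (ψ (Ideal.absNorm q.asIdeal))) ∧
          (∃ l ∈ cycIntLattice 3 (cycLevel 3 0 r),
            (((3 : ℕ) : ℤ_[3]) ^ t) • ((1 : ℚ_[3]) ⊗ₜ[ℚ]
              ((r.noncommProd 𝐃F⟦r, σ⟧ (ZetaValue.pairwise_commute_fieldDeriv (cycLevel 3 0 r)
                  (fun ℓ => modNCyclotomicCharacter ℚ (cycLevel 3 0 r) (σ ℓ))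
                  (fun ℓ => ((primesEquiv ℓ : Nat.Primes) : ℕ) - 1) r))
                (x 0 ⟨r, fun _ hq => hPr (hr (Finset.mem_coe.2 hq))⟩ +
                  sigma (cycLevel 3 0 r) (-1) (x 0 ⟨r, fun _ hq => hPr (hr (Finset.mem_coe.2 hq))⟩)))) -
              ((s : ℚ_[3]) ⊗ₜ[ℚ] (1 : CyclotomicField (cycLevel 3 0 r) ℚ)) =
            (((3 : ℕ) : ℤ_[3]) ^ (k + 1)) • (l : ℚ_[3] ⊗[ℚ] CyclotomicField (cycLevel 3 0 r) ℚ)) ∧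
          haveI : NeZero (∏ q ∈ r, Ideal.absNorm q.asIdeal) :=
            ⟨Finset.prod_ne_zero_iff.2 fun q _ h => q.ne_bot (Ideal.absNorm_eq_zero_iff.1 h)⟩
          PadicInt.toZModPow (k + 1) s = (u : ZMod (3 ^ (k + 1))) *
            ((3 : ℕ) : ZMod (3 ^ (k + 1))) ^ t *
              kuriharaNumber P.f (3 ^ (k + 1)) (∏ q ∈ r, Ideal.absNorm q.asIdeal) ψ)
    (hvalm : ∀ σ : HeightOneSpectrum (𝓞 ℚ) → absoluteGaloisGroup ℚ,
      (∀ q, σ q ∈ (adicCompletionPrime ℚ q).inertia (absoluteGaloisGroup ℚ)) →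
      (∀ q, modNCyclotomicCharacter ℚ (Ideal.absNorm q.asIdeal) (σ q) = η q) →
      ∀ (r : Finset (HeightOneSpectrum (𝓞 ℚ))) (hr : (↑r : Set _) ⊆ D''.primes),
        ∃ (s : ℤ_[3]) (u : (ZMod (3 ^ (m + 1)))ˣ)
          (ψ : (ℓ : ℕ) → (ZMod ℓ)ˣ →* Multiplicative (ZMod (3 ^ (m + 1)))),
          (∀ q ∈ r, Function.Surjective (ψ (Ideal.absNorm q.asIdeal))) ∧
          (∃ l ∈ cycIntLattice 3 (cycLevel 3 0 r),
            (((3 : ℕ) : ℤ_[3]) ^ t) • ((1 : ℚ_[3]) ⊗ₜ[ℚ]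
              ((r.noncommProd 𝐃F⟦r, σ⟧ (ZetaValue.pairwise_commute_fieldDeriv (cycLevel 3 0 r)
                  (fun ℓ => modNCyclotomicCharacter ℚ (cycLevel 3 0 r) (σ ℓ))
                  (fun ℓ => ((primesEquiv ℓ : Nat.Primes) : ℕ) - 1) r))
                (x 0 ⟨r, fun _ hq => hPr'' (hr (Finset.mem_coe.2 hq))⟩ +
                  sigma (cycLevel 3 0 r) (-1) (x 0 ⟨r, fun _ hq => hPr'' (hr (Finset.mem_coe.2 hq))⟩)))) -
              ((s : ℚ_[3]) ⊗ₜ[ℚ] (1 : CyclotomicField (cycLevel 3 0 r) ℚ)) =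
            (((3 : ℕ) : ℤ_[3]) ^ (m + 1)) • (l : ℚ_[3] ⊗[ℚ] CyclotomicField (cycLevel 3 0 r) ℚ)) ∧
          haveI : NeZero (∏ q ∈ r, Ideal.absNorm q.asIdeal) :=
            ⟨Finset.prod_ne_zero_iff.2 fun q _ h => q.ne_bot (Ideal.absNorm_eq_zero_iff.1 h)⟩
          PadicInt.toZModPow (m + 1) s = (u : ZMod (3 ^ (m + 1))) *
            ((3 : ℕ) : ZMod (3 ^ (m + 1))) ^ t *
              kuriharaNumber P.f (3 ^ (m + 1)) (∏ q ∈ r, Ideal.absNorm q.asIdeal) ψ) :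
    ∃ (κf : Finset (HeightOneSpectrum (𝓞 ℚ)) →
          galoisCohomology (W.torsionGaloisModule (((3 : ℕ) : ℤ) ^ k * ((3 : ℕ) : ℤ))) 1)
      (κu : Finset (HeightOneSpectrum (𝓞 ℚ)) →
          galoisCohomology (W.torsionGaloisModule (((3 : ℕ) : ℤ) ^ m * ((3 : ℕ) : ℤ))) 1),
      KatoKuriharaWitnessAt W k t D v₃ P κf Λk κf ∧
      KatoKuriharaWitnessAt W m t D'' v₃ P κu Λm κu ∧
      ∀ e, D''.IsLevel e → D.IsLevel e → galoisCohomology.map π 1 (κu e) = κf e := by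
  letI := TorsionCoeff.torsionBy.padicIntModule 3 (k + 1) (WeierstrassCurve.geomPoints W)
  letI := TorsionCoeff.torsionBy.padicIntModule 3 (m + 1) (WeierstrassCurve.geomPoints W)
  have hv₃p : ((primesEquiv v₃ : Nat.Primes) : ℕ) = 3 := primesEquiv_eq_of_natCast_mem Nat.prime_three hv₃
  -- the two coefficient systems `E[3^{j+1}]_{ℤ₃}` (GZ-2), reductions onto, pins `rfl`
  have hredk : Function.Surjective
      (tateModuleRed W 3 (W.continuous_galoisRepTate_holds 3) (k + 1)).hom := by
    intro y
    obtain ⟨b, hb⟩ := W.proj_surjective_of_isAlgClosed_holds 3 (k + 1) y.2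
    exact ⟨b, Subtype.ext hb⟩
  have hredm : Function.Surjective
      (tateModuleRed W 3 (W.continuous_galoisRepTate_holds 3) (m + 1)).hom := by
    intro y
    obtain ⟨b, hb⟩ := W.proj_surjective_of_isAlgClosed_holds 3 (m + 1) y.2
    exact ⟨b, Subtype.ext hb⟩
  -- THEOREM D at the two depths for Kato's system `z` (D7): ONE `σ`, (COMP)
  obtain ⟨σ, Φ, comm, κf, Φ'', comm'', κu, hσI, hσχ, hΦ, hΦ'', hKS, hKS'', -, -, hres, hres'', hcomp⟩ :=
    Derivative.Rat.exists_isKolyvaginSystem_pair_propagatedSelmerStructure W 3 (badPlaces c d A N)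
      (by decide) hkm hbody.1
      (tateModuleRed W 3 (W.continuous_galoisRepTate_holds 3) (k + 1)) hredk
      (fun y => pow_smul_eq_zero 3 (k + 1) _ y)
      (AddSubgroup.inclusion (geomTorsion_pow_succ_eq W 3 k).le : _ →+ _) continuous_of_discreteTopology
      (fun _ _ => rfl)
      (AddSubgroup.inclusion (geomTorsion_pow_succ_eq W 3 k).ge : _ →+ _) continuous_of_discreteTopology
      (fun y => Subtype.ext rfl) (fun y => Subtype.ext rfl) (fun _ => rfl)
      (tateModuleRed W 3 (W.continuous_galoisRepTate_holds 3) (m + 1)) hredm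
      (fun y => pow_smul_eq_zero 3 (m + 1) _ y)
      (AddSubgroup.inclusion (geomTorsion_pow_succ_eq W 3 m).le : _ →+ _) continuous_of_discreteTopology
      (fun _ _ => rfl)
      (AddSubgroup.inclusion (geomTorsion_pow_succ_eq W 3 m).ge : _ →+ _) continuous_of_discreteTopology
      (fun y => Subtype.ext rfl) (fun y => Subtype.ext rfl) (fun _ => rfl)
      π hπ hirr D hT D'' hT'' hD hD'' hPr hPr'' hKol hKol'' hbad htopk htopm
  refine ⟨κf, κu, ?_, ?_, fun e he'' he => hcomp e he he''⟩
  · -- depth `k`: (0), (I4) with `κ′ = κ`, (Λ) from the rider, (DICT3) per level from T-PK6-GEN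
    refine ⟨fun e he => hKS.mem_selmerGroup e he,
      ⟨hKS, fun e _ => by rw [sub_self]; exact zero_mem _⟩, hfink.1, hfink.2.1, fun r hr => ?_⟩
    obtain ⟨s, u, ψ, hψ, hval, hw⟩ := hvalk σ hσI hσχ r hr
    obtain ⟨u', hu'⟩ := GeneralLevel.exists_unit_apply_localization_eq_of_derivativeFamily W 3 P.f ι κK Λ
      c d a A z x (by decide) hbody hfink
      (tateModuleRed W 3 (W.continuous_galoisRepTate_holds 3) (k + 1))
      (AddSubgroup.inclusion (geomTorsion_pow_succ_eq W 3 k).le : _ →+ _) continuous_of_discreteTopology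
      (fun _ _ => rfl) (fun _ => rfl) D hPr σ Φ comm κf hΦ hKS hres hv₃p r hr s hval u hw
    exact ⟨u', ψ, hψ, hu'⟩
  · -- depth `m`: the same
    refine ⟨fun e he => hKS''.mem_selmerGroup e he,
      ⟨hKS'', fun e _ => by rw [sub_self]; exact zero_mem _⟩, hfinm.1, hfinm.2.1, fun r hr => ?_⟩
    obtain ⟨s, u, ψ, hψ, hval, hw⟩ := hvalm σ hσI hσχ r hr
    obtain ⟨u', hu'⟩ := GeneralLevel.exists_unit_apply_localization_eq_of_derivativeFamily W 3 P.f ι κK Λ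
      c d a A z x (by decide) hbody hfinm
      (tateModuleRed W 3 (W.continuous_galoisRepTate_holds 3) (m + 1))
      (AddSubgroup.inclusion (geomTorsion_pow_succ_eq W 3 m).le : _ →+ _) continuous_of_discreteTopology
      (fun _ _ => rfl) (fun _ => rfl) D'' hPr'' σ Φ'' comm'' κu hΦ'' hKS'' hres'' hv₃p r hr s hval u hw
    exact ⟨u', ψ, hψ, hu'⟩

end Summit.BirchSwinnertonDyer.Rank1Residual.GaloisImage.KatoValue

end
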